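import Literature.MathematicalPhysics.QuantumFieldTheory.Balaban1983to89.B8LeafModelZdPer
import Literature.MathematicalPhysics.QuantumFieldTheory.Balaban1983to89.B8TorusShiftLandau
import Literature.MathematicalPhysics.QuantumFieldTheory.Balaban1983to89.B7TranslationCovariance

/-!
# `Balaban1983to89.B8LeafModelZdPerTransfer` — [Balaban1985RegularSpaces] THEOREMS 2 AND 4 PASS FROM THE `ℤᵈ` FAMILY `zdGF3` TO ITS
# `P`-PERIODIC SUB-MODEL `zdGF3Per` AT EVERY MEMBER WITH PERIODIC GEOMETRY: «exactly one gauge transformation u» ⇒ `u` IS PERIODIC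
# (the G-B8-T2S device «uniqueness ⇒ periodicity», here for a GENERAL admissible domain sequence)

statement-level skeleton of published theorems with citation tags; proofs where landed; nothing here is a claim about the
Yang–Mills mass gap

PDF held: `paper:balaban1985-cmp99-regular-spaces-gauge-fixing` (journal page = PDF page + 74); pp. 77, 81–83, 86–88.

## THE PRINTED TEXT

p. 83 [PDF 9]: «**Theorem 2.** There exist constants B₁, B₂(β₀), c₁ such that for arbitrary U₀, U′U₀ satisfying (1.33)–(1.35) with α₀ + α₁ ≤ c₁, there exists
exactly one gauge transformation u defined on Ω₀, satisfying (1.29) and such that the following conditions are satisfied [(1.36)–(1.39)]»;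
p. 88 [PDF 14]: «**Theorem 4.** There exists a constant c₁ such that for arbitrary U₀, U′U₀ satisfying (1.33), (1.34), (1.66) with α₀ + α₁ ≤ c₁ there
exists exactly one gauge transformation u defined on Ω₀, with values in the group G, satisfying the conditions R₀ūʲ = 1 on Λ_j and (1.37), (1.38), (1.62)»;
p. 77 [PDF 3]: every object lives on the finite torus `T_η` («we admit the case when some domains Ω_j are equal to T_η»).

## WHY THIS FILE (cell `pub-ymgap`, HUMAN RULING D-0062; director-ym №217 (1) (Q2): the (β′-PERIODIC) road behind the ∅ [B8] display; plan g86 PENS-217;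
dag-n05-d g14's P4 DESIGN + P3-REQUEST «the ∃-witness members t2 ∕ t4 ∕ t8 at the periodic family need the transfer — TAKEN by dag-n05-c (P1 lineage)»; count-neutral)

N05's knits prove the ℤᵈ member theorems `B8.Thm2Printed ∕ Thm4Printed (fun j => (zdGF3 … (ι j)).toGFData)` (modulo [4]-type sockets).  The periodic pin
(`Node00/CarriersB8Per`, dag-n05-w1) reads the leaf over the PERIODIC family `famB8OfRecordPer θ β len P j := zdGF3Per θ.𝔸 θ.L β len j.toZdIdx P` (P1,
`B8LeafModelZdPer`).  Hypotheses pass from periodic data to the ℤᵈ member for free (P1 §3, `Iff.rfl`); the CONCLUSION «∃! u» does not: the ℤᵈ witness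
`u : zdGF3.GT` must be shown `P`-periodic to be a `zdGF3Per.GT`.  THE DEVICE (lit-balaban's `B8Thm2TorusPeriodic.thm2_torus_periodic_of_socketsE` for
«Ω_j = T_η ∀ j», generalised here to EVERY domain sequence with `P`-periodic `Ω_l` and label-periodic towers `Λs ∕ 𝔅`): the translate `t_v u`, `v ∈ Pℤᵈ`,
satisfies (1.29) and (1.36)–(1.39) ∕ (1.37), (1.38), (1.62) for the SAME (periodic) data — every clause of n05-a's `zdGF3` bodies is translation covariant at
periodic geometry (§2–§4) — hence equals `u` by print's «exactly one»; uniqueness inside the periodic class is the ℤᵈ one restricted.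

## WHAT IS PROVED (kernel, 0 sorry; theorems only)

§1 set-level shift invariance at a periodic set: `plaqTouches_add_iff`, `isSide_add_iff`, `sideTouches_add_iff`, `bondTouches_add_iff`, `indicator_shiftCfg_of_periodic`;
§2 ★ `mlogCfg_shiftCfg_of_periodic` (the canonical masked exponent of translated data at periodic `Ω`), `iEta_shiftCfg`, ★ `bondNorm_shiftCfg_of_periodic`;
§3 ★ `restr129_shiftCfg_of_periodic` ((1.29) at label-periodic towers), ★ `QT_shiftCfg_of_periodic`, ★ `isLandau138_shiftCfg_of_periodic` ((1.38), multiplier form);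
§4 the clauses in `zdGF3`'s exact bodies are translation covariant at periodic geometry, one lemma each: ★ `c162_shiftCfg_of_periodic` ((1.36)₁ ∕ (1.62)),
★ `c136grad_shiftCfg_of_periodic` ((1.36)₂), ★ `c136holder_shiftCfg_of_periodic` ((1.36)₃), ★ `c137_shiftCfg_of_periodic`, ★ `landauW_shiftCfg_of_periodic`, ★ `c139_shiftCfg_of_periodic`;
§5 `period_smul_eq_pow_smul`, ★★ `isPeriodic_of_unique` (THE DEVICE, abstract in the property), ★★★ `thm4Printed_per_of_zd`, ★★★ `thm2Printed_per_of_zd` — along any index ∕ period maps `ι, p` with `P`-periodic `Ω_l`, `Lᵏ ∣ P`, and `(P∕Lʲ)`-periodic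
`Λs k j ∕ Λb k j` (`j ≤ k`; at the (1.5)-members these are dag-n05-w2's `B8IdxB8SubDPeriodicTowers` theorems, at `IdxB8SubDPer` members the law fields):
`B8.Thm4Printed B₁′ (zdGF3 ∘ ι) → B8.Thm4Printed B₁′ (zdGF3Per ∘ (ι, p))`, same for Theorem 2 — SAME constants.

## HONEST SCOPE

Bookkeeping ∕ translation covariance + two transfers of EXISTING ℤᵈ member theorems; nothing of [Balaban1985RegularSpaces]'s estimates is proved; the ℤᵈ
theorems' sockets are whatever their knits display (OUTER re-key: binders at periodic MEMBERS, inner arguments still over all `ℤᵈ` fields; the periodic-ARGUMENT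
socket editions are N06's lane).  Theorem 8 (surviving form) is the sibling file's (tranche B).  `d ≥ 1` not needed; `L ≥ 1`.  Count-neutral; N05 NOT
discharged; one finite `T⁴` programme at fixed `ε`; nothing continuum ∕ ℝ⁴ ∕ OS ∕ mass-gap ∕ Clay.  Unit `pub-ymgap-dag-n05-c` (g16), 2026-08-28.  No `sorry`,
no `def`, no `instance`, no `notation`.
-/

noncomputable section

open NormedSpace

namespace Literature.MathematicalPhysics.QuantumFieldTheory.Balaban1983to89.B8LeafModelZdPerTransfer

open B7Prop1Explicit B7Prop2Explicit B7Eq92Concrete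
open B7Eq78Linearization (zdBlocking Rbar)
open B7Prop4GeneralLevels (logCovIter)
open B8Ineq132 (covDerivFwd BondTouches PlaqTouches)
open B8Eq140Level (SideTouches IsSide)
open B8Eq119TwistedAxial (Restr129 bgT)
open B8Eq184Proof (cfgExp)
open B8Eq146AExpansion (iEta plaqCovDeriv)
open B8Eq143PlaqExpansion (pdiv)
open B8Eq138LandauZd (IsLandau138 IsLandau138W covLap covDivB QT QprimeT logCfg)
open B8ScaledSupNorm (msup bondNorm)
open B9Eq340HolderZd (hquot AdmPair)
open B8LeafModelZd (ZdIdx)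
open B8LeafModelZd3 (zdGF3 mlogCfg mlogCfg_of_sideTouches mlogCfg_of_not)
open B8LeafModelZdPer (zdGF3Per cfgZd pertZd gtZd)
open T4TermwiseTorus (IsPeriodic)
open B12Ineq417Flat (shiftCfg shiftCfg_apply)
open B7TranslationCovariance (mgauge_shiftCfg logCovIter_shiftCfg)
open B8TorusShiftStencils (covDerivFwd_shiftCfg covLap_shiftCfg covDivB_shiftCfg pdiv_plaqCovDeriv_shiftCfg logCfg_shiftCfg cfgExp_shiftCfg'
  hquot_shiftCfg admPair_shift_iff msup_shift_univ)
open B8TorusShiftAveraging (Rbar_bgT_shiftCfg)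
open B8TorusShiftLandau (QprimeT_shiftCfg)

-- `Site` alone could resolve to the torus sites of `Setup.lean`; re-export the `ℤ^d` sites of `B7Prop1Explicit`.
export B7Prop1Explicit (Site)

variable {d : ℕ}

/-! ## §1 Set-level shift invariance at a periodic set -/

section Sets

/-- A plaquette touches a `v`-invariant set iff its `v`-translate does. [cite: Balaban1985RegularSpaces, p.77 (plaquette convention); Balaban1987RG1, (4.16) p.285] -/
theorem plaqTouches_add_iff {S : Set (Site d)} {v : Site d} (hS : ∀ x, x + v ∈ S ↔ x ∈ S) (z : Site d) (κ ν : Fin d) :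
    PlaqTouches S (z + v) κ ν ↔ PlaqTouches S z κ ν := by
  unfold PlaqTouches
  rw [add_right_comm z v (e κ), add_right_comm z v (e ν), add_right_comm (z + e κ) v (e ν), hS, hS, hS, hS]

/-- «the bond `⟨y, y + e_τ⟩` is a side of the plaquette `p_{κν}(z)`» is translation invariant. [cite: Balaban1985RegularSpaces, p.77 (bond convention)] -/
theorem isSide_add_iff (v z : Site d) (κ ν : Fin d) (y : Site d) (τ : Fin d) :
    IsSide (z + v) κ ν (y + v) τ ↔ IsSide z κ ν y τ := by
  simp only [IsSide, add_right_comm z v, add_left_inj]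

/-- The (1.36)-class «sides of plaquettes touching `Ω_j`» of a `v`-invariant `Ω_j` is `v`-invariant. [cite: Balaban1985RegularSpaces, (1.36) p.82, p.77] -/
theorem sideTouches_add_iff {S : Set (Site d)} {v : Site d} (hS : ∀ x, x + v ∈ S ↔ x ∈ S) (y : Site d) (τ : Fin d) :
    SideTouches S (y + v) τ ↔ SideTouches S y τ := by
  constructor
  · rintro ⟨z, κ, ν, hne, hP, hI⟩
    have hz : z = (z - v) + v := (sub_add_cancel z v).symm
    rw [hz] at hP hI
    exact ⟨z - v, κ, ν, hne, (plaqTouches_add_iff hS _ κ ν).1 hP, (isSide_add_iff v _ κ ν y τ).1 hI⟩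
  · rintro ⟨z, κ, ν, hne, hP, hI⟩
    exact ⟨z + v, κ, ν, hne, (plaqTouches_add_iff hS z κ ν).2 hP, (isSide_add_iff v z κ ν y τ).2 hI⟩

/-- The class «bonds touching `Ω_j`» of a `v`-invariant `Ω_j` is `v`-invariant. [cite: Balaban1985RegularSpaces, p.77 (bond convention)] -/
theorem bondTouches_add_iff {S : Set (Site d)} {v : Site d} (hS : ∀ x, x + v ∈ S ↔ x ∈ S) (y : Site d) (τ : Fin d) :
    BondTouches S (y + v) τ ↔ BondTouches S y τ := by
  unfold BondTouches
  rw [add_right_comm y v (e τ), hS, hS]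

/-- A `P`-periodic set is invariant under every `P·m`. [cite: Balaban1985RegularSpaces, p.77 («Ω_j ⊂ T_η»); Balaban1987RG1, (0.1) p.251] -/
theorem mem_add_iff_of_isPeriodic {P : ℕ} {S : Set (Site d)} (hS : IsPeriodic P (fun x : Site d => x ∈ S)) (x m : Site d) :
    x + (P : ℤ) • m ∈ S ↔ x ∈ S :=
  Iff.of_eq (hS x m)

/-- Restriction to a `v`-invariant set commutes with translation by `v`. [cite: Balaban1985RegularSpaces, (1.38) p.82 («Δ↾Ω₀»), p.77] -/
theorem indicator_shiftCfg_of_periodic {β : Type*} [Zero β] {S : Set (Site d)} {v : Site d} (hS : ∀ x, x + v ∈ S ↔ x ∈ S) (g : Site d → β) :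
    S.indicator (shiftCfg v g) = shiftCfg v (S.indicator g) := by
  classical
  funext x
  simp only [shiftCfg_apply, Set.indicator_apply]
  by_cases hx : x ∈ S
  · rw [if_pos hx, if_pos ((hS x).2 hx)]
  · rw [if_neg hx, if_neg (fun h => hx ((hS x).1 h))]

end Sets

/-! ## §2 The canonical masked exponent, `iη·`, and the bond norms at periodic `Ω` -/

section Exponent

variable {𝔸 : Type*} [CStarAlgebra 𝔸]

/-- ★ **THE CANONICAL MASKED EXPONENT OF TRANSLATED DATA IS THE TRANSLATED EXPONENT** at every `v` leaving all `Ω_j` invariant: the mask «side of a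
plaquette touching some `Ω_j`, `j ≤ k`» is `v`-invariant (§1) and the logarithm is pointwise. [cite: Balaban1985RegularSpaces, (1.36) p.82 («U₁ = exp iηA»), p.77] -/
theorem mlogCfg_shiftCfg_of_periodic (k : ℕ) (η : ℝ) {Ω : ℕ → Set (Site d)} {v : Site d} (hΩ : ∀ j x, x + v ∈ Ω j ↔ x ∈ Ω j)
    (W : Site d → Fin d → 𝔸ˣ) : mlogCfg k η Ω (shiftCfg v W) = shiftCfg v (mlogCfg k η Ω W) := by
  funext y τ
  rw [shiftCfg_apply]
  by_cases h : ∃ j, j ≤ k ∧ SideTouches (Ω j) y τ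
  · obtain ⟨j, hj, hs⟩ := h
    rw [mlogCfg_of_sideTouches η _ hj hs, mlogCfg_of_sideTouches η _ hj ((sideTouches_add_iff (hΩ j) y τ).2 hs), logCfg_shiftCfg,
      shiftCfg_apply]
  · rw [mlogCfg_of_not η _ (fun j hj hs => h ⟨j, hj, hs⟩), mlogCfg_of_not η _ (fun j hj hs => h ⟨j, hj, (sideTouches_add_iff (hΩ j) y τ).1 hs⟩)]

/-- `iη·(t_vA) = t_v(iηA)` (pointwise). [cite: Balaban1985RegularSpaces, (1.37) p.82 (`Q_j(U₀, ηA)`)] -/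
theorem iEta_shiftCfg (η : ℝ) (v : Site d) (A : Site d → Fin d → 𝔸) :
    iEta η (shiftCfg v A) = shiftCfg v (iEta η A) := rfl

/-- ★ **The bond norm `|A|₍α₎` over a `v`-invariant domain sequence is translation invariant**: `|t_vA|₍α₎ = |A|₍α₎` (re-indexing the p. 86 supremum by the
bond translation). [cite: Balaban1985RegularSpaces, p.86 (definition after (1.55)), p.77] -/
theorem bondNorm_shiftCfg_of_periodic {E : Type*} [SeminormedAddCommGroup E] (L k : ℕ) (η α : ℝ) {Ω : ℕ → Set (Site d)} {v : Site d}
    (hΩ : ∀ j x, x + v ∈ Ω j ↔ x ∈ Ω j) (A : Site d → Fin d → E) :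
    bondNorm L k η α Ω (shiftCfg v A) = bondNorm L k η α Ω A := by
  unfold bondNorm
  let σ : Site d × Fin d ≃ Site d × Fin d :=
    { toFun := fun b => (b.1 + v, b.2)
      invFun := fun b => (b.1 - v, b.2)
      left_inv := fun b => by simp
      right_inv := fun b => by simp }
  have h := msup_shift_univ L k η α (fun j (b : Site d × Fin d) => BondTouches (Ω j) b.1 b.2) σ
    (fun j b => (bondTouches_add_iff (hΩ j) b.1 b.2).symm) (fun b => A b.1 b.2)
  simpa [σ, shiftCfg_apply] using h

end Exponent

/-! ## §3 (1.29) and (1.38) at periodic geometry -/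

section Averaging

variable {𝔸 : Type*} [NormedRing 𝔸] [NormedAlgebra ℂ 𝔸] [CompleteSpace 𝔸]

/-- ★ **(1.29) AT LABEL-PERIODIC TOWERS IS TRANSLATION INVARIANT**: if `(R̄₀uʲ)(y) = 1` for `y ∈ Λ_j`, `j ≤ k`, and each `Λ_j` is invariant under the
level-`j` label translation `q_j` with `v = Lʲq_j`, then (1.29) holds for the pair `(t_vU₀, t_vu)` (`B8TorusShiftAveraging.Rbar_bgT_shiftCfg`).
[cite: Balaban1985RegularSpaces, (1.29) p.81, (1.28) p.81, p.77 («Ω_j ⊂ T_η»)] -/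
theorem restr129_shiftCfg_of_periodic (L k : ℕ) (Λ : ℕ → Set (Site d)) (U₀ : Site d → Fin d → 𝔸ˣ) (u : Site d → 𝔸ˣ)
    (q : ℕ → Site d) (v : Site d) (hv : ∀ j, j ≤ k → v = ((L : ℤ) ^ j) • q j) (hΛ : ∀ j, j ≤ k → ∀ y, y + q j ∈ Λ j ↔ y ∈ Λ j)
    (h : Restr129 L k Λ U₀ u) : Restr129 L k Λ (shiftCfg v U₀) (shiftCfg v u) := by
  intro j hj y hy
  rw [hv j hj]
  have hc : (fun x => ((shiftCfg (((L : ℤ) ^ j) • q j) u x : 𝔸ˣ) : 𝔸)) = shiftCfg (((L : ℤ) ^ j) • q j) (fun x => ((u x : 𝔸ˣ) : 𝔸)) := rfl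
  rw [hc, Rbar_bgT_shiftCfg]
  exact h j hj (y + q j) ((hΛ j hj y).2 hy)

/-- ★ **`Q′(U₀)ᵀμ` ON `𝔅_k` AT LABEL-PERIODIC `Λ`, TRANSLATED**: with the multiplier translated level by level (`μ′_j = t_{q_j}μ_j`, `v = Lʲq_j`),
`Q′(t_vU₀)ᵀμ′(x) = (Q′(U₀)ᵀμ)(x + v)`. [cite: Balaban1985BackgroundPropagators, (3.24) p.394; Balaban1985RegularSpaces, (1.29) p.81, p.77] -/
theorem QT_shiftCfg_of_periodic {L : ℕ} (hL : 1 ≤ L) (k : ℕ) (Λ : ℕ → Set (Site d)) (U₀ : Site d → Fin d → 𝔸ˣ) (μ : ℕ → Site d → 𝔸)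
    (q : ℕ → Site d) (v : Site d) (hv : ∀ j, j ≤ k → v = ((L : ℤ) ^ j) • q j) (hΛ : ∀ j, j ≤ k → ∀ y, y + q j ∈ Λ j ↔ y ∈ Λ j) (x : Site d) :
    QT L k Λ (shiftCfg v U₀) (fun j => shiftCfg (q j) (μ j)) x = QT L k Λ U₀ μ (x + v) := by
  unfold QT
  refine Finset.sum_congr rfl fun j hj => ?_
  have hjk : j ≤ k := Nat.lt_succ_iff.1 (Finset.mem_range.1 hj)
  rw [indicator_shiftCfg_of_periodic (hΛ j hjk) (μ j), hv j hjk, QprimeT_shiftCfg hL]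

/-- ★ **(1.38) IN MULTIPLIER FORM IS TRANSLATION INVARIANT AT PERIODIC GEOMETRY**: if `Δ^η_{U₀}↾Ω₀(D^{η*}_{U₀}A) = Q′(U₀)ᵀμ` on `Ω₀` for some level
multipliers `μ`, with `Ω₀` `v`-invariant and `Λ_j` `q_j`-invariant (`v = Lʲq_j`), then the same holds for the pair translated by `v` (with the translated
multipliers). [cite: Balaban1985RegularSpaces, (1.38) p.82, p.77; Balaban1985BackgroundPropagators, (3.23)–(3.25) p.394] -/
theorem isLandau138_shiftCfg_of_periodic {L : ℕ} (hL : 1 ≤ L) (k : ℕ) (η : ℝ) (Ω₀ : Set (Site d)) (Λ : ℕ → Set (Site d))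
    (U₀ : Site d → Fin d → 𝔸ˣ) (A : Site d → Fin d → 𝔸) (q : ℕ → Site d) (v : Site d) (hv : ∀ j, j ≤ k → v = ((L : ℤ) ^ j) • q j)
    (hΩ₀ : ∀ x, x + v ∈ Ω₀ ↔ x ∈ Ω₀) (hΛ : ∀ j, j ≤ k → ∀ y, y + q j ∈ Λ j ↔ y ∈ Λ j) (h : IsLandau138 L k η Ω₀ Λ U₀ A) :
    IsLandau138 L k η Ω₀ Λ (shiftCfg v U₀) (shiftCfg v A) := by
  obtain ⟨μ, hμ⟩ := h
  refine ⟨fun j => shiftCfg (q j) (μ j), fun x hx => ?_⟩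
  rw [QT_shiftCfg_of_periodic hL k Λ U₀ μ q v hv hΛ x, ← hμ (x + v) ((hΩ₀ x).2 hx)]
  have hc : covDivB η (shiftCfg v U₀) (shiftCfg v A) = shiftCfg v (covDivB η U₀ A) := by
    funext z
    rw [covDivB_shiftCfg, shiftCfg_apply]
  rw [hc, indicator_shiftCfg_of_periodic hΩ₀, covLap_shiftCfg]

end Averaging

/-! ## §4 The clauses of Theorems 2 ∕ 4 in `zdGF3`'s bodies are translation covariant at periodic geometry -/

section Clauses

variable {𝔸 : Type} [CStarAlgebra 𝔸]

/-- **(1.36)₁ ∕ (1.62) (pointwise exponent bounds on the sides touching `Ω_j`) are translation covariant** at `v`-invariant `Ω_j`.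
[cite: Balaban1985RegularSpaces, (1.36) p.82, (1.62) p.87, p.77] -/
theorem c162_shiftCfg_of_periodic (L k : ℕ) (η C : ℝ) {Ω : ℕ → Set (Site d)} {v : Site d} (hΩ : ∀ j x, x + v ∈ Ω j ↔ x ∈ Ω j)
    (W : Site d → Fin d → 𝔸ˣ)
    (h : ∀ j, j ≤ k → ∀ b ∈ {b : Site d × Fin d | SideTouches (Ω j) b.1 b.2},
      W b.1 b.2 = cfgExp η (logCfg η W) b.1 b.2 ∧ IsSelfAdjoint (logCfg η W b.1 b.2) ∧ ‖logCfg η W b.1 b.2‖ ≤ C * ((L : ℝ) ^ j * η)⁻¹) :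
    ∀ j, j ≤ k → ∀ b ∈ {b : Site d × Fin d | SideTouches (Ω j) b.1 b.2},
      shiftCfg v W b.1 b.2 = cfgExp η (logCfg η (shiftCfg v W)) b.1 b.2 ∧ IsSelfAdjoint (logCfg η (shiftCfg v W) b.1 b.2) ∧
        ‖logCfg η (shiftCfg v W) b.1 b.2‖ ≤ C * ((L : ℝ) ^ j * η)⁻¹ := by
  intro j hj b hb
  have hb' : SideTouches (Ω j) (b.1 + v) b.2 := (sideTouches_add_iff (hΩ j) b.1 b.2).2 hb
  have h' := h j hj (b.1 + v, b.2) hb'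
  simpa only [logCfg_shiftCfg, cfgExp_shiftCfg', shiftCfg_apply] using h'

/-- **(1.36)₂ (the weighted sup of the covariant gradient of the masked exponent over the sides touching `Ω_j`) is translation covariant** at
`v`-invariant `Ω_j` (re-indexing the p. 86 supremum). [cite: Balaban1985RegularSpaces, (1.36) p.82, p.86, p.77] -/
theorem c136grad_shiftCfg_of_periodic (L k : ℕ) (η C : ℝ) {Ω : ℕ → Set (Site d)} {v : Site d} (hΩ : ∀ j x, x + v ∈ Ω j ↔ x ∈ Ω j)
    (U₀ W : Site d → Fin d → 𝔸ˣ)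
    (h : msup L k η (-(2 : ℝ)) (fun j (t : Fin d × Fin d × Site d) => SideTouches (Ω j) t.2.2 t.2.1)
      (fun t => covDerivFwd η U₀ t.1 (fun z => mlogCfg k η Ω W z t.2.1) t.2.2) ≤ C) :
    msup L k η (-(2 : ℝ)) (fun j (t : Fin d × Fin d × Site d) => SideTouches (Ω j) t.2.2 t.2.1)
      (fun t => covDerivFwd η (shiftCfg v U₀) t.1 (fun z => mlogCfg k η Ω (shiftCfg v W) z t.2.1) t.2.2) ≤ C := by
  have hml : mlogCfg k η Ω (shiftCfg v W) = shiftCfg v (mlogCfg k η Ω W) := mlogCfg_shiftCfg_of_periodic k η hΩ W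
  set A : Site d → Fin d → 𝔸 := mlogCfg k η Ω W with hA
  have hF : (fun t : Fin d × Fin d × Site d => covDerivFwd η (shiftCfg v U₀) t.1 (fun z => mlogCfg k η Ω (shiftCfg v W) z t.2.1) t.2.2)
      = fun t => (fun t' : Fin d × Fin d × Site d => covDerivFwd η U₀ t'.1 (fun z => A z t'.2.1) t'.2.2) (t.1, t.2.1, t.2.2 + v) := by
    funext t
    rw [hml]
    exact covDerivFwd_shiftCfg η v U₀ t.1 (fun z => A z t.2.1) t.2.2
  rw [hF]
  let σ : (Fin d × Fin d × Site d) ≃ (Fin d × Fin d × Site d) :=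
    { toFun := fun t => (t.1, t.2.1, t.2.2 + v), invFun := fun t => (t.1, t.2.1, t.2.2 - v),
      left_inv := fun t => by simp, right_inv := fun t => by simp }
  have hσ := msup_shift_univ L k η (-(2 : ℝ)) (fun j (t : Fin d × Fin d × Site d) => SideTouches (Ω j) t.2.2 t.2.1) σ
    (fun j t => (sideTouches_add_iff (hΩ j) t.2.2 t.2.1).symm) (fun t' => covDerivFwd η U₀ t'.1 (fun z => A z t'.2.1) t'.2.2)
  exact (le_of_eq hσ).trans h

/-- **(1.36)₃ (the Hölder member: weighted sup of the (3.40)-quotients of the covariant gradient over admissible pairs starting in `Ω_j`) is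
translation covariant** at `v`-invariant `Ω_j` (`len` enters through `x′ − x` only). [cite: Balaban1985RegularSpaces, (1.36) p.82, p.86; Balaban1985BackgroundPropagators, (3.40) p.397] -/
theorem c136holder_shiftCfg_of_periodic (L k : ℕ) (η β : ℝ) (len : Site d → ℝ) (C : ℝ) {Ω : ℕ → Set (Site d)} {v : Site d}
    (hΩ : ∀ j x, x + v ∈ Ω j ↔ x ∈ Ω j) (U₀ W : Site d → Fin d → 𝔸ˣ)
    (h : msup L k η (-(2 + β)) (fun j (t : Fin d × Fin d × (Site d × Site d)) => t.2.2 ∈ AdmPair η len ∧ t.2.2.1 ∈ Ω j)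
      (fun t => hquot η β len U₀ (covDerivFwd η U₀ t.1 (fun z => mlogCfg k η Ω W z t.2.1)) t.2.2) ≤ C) :
    msup L k η (-(2 + β)) (fun j (t : Fin d × Fin d × (Site d × Site d)) => t.2.2 ∈ AdmPair η len ∧ t.2.2.1 ∈ Ω j)
      (fun t => hquot η β len (shiftCfg v U₀) (covDerivFwd η (shiftCfg v U₀) t.1 (fun z => mlogCfg k η Ω (shiftCfg v W) z t.2.1)) t.2.2) ≤ C := by
  have hml : mlogCfg k η Ω (shiftCfg v W) = shiftCfg v (mlogCfg k η Ω W) := mlogCfg_shiftCfg_of_periodic k η hΩ W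
  set A : Site d → Fin d → 𝔸 := mlogCfg k η Ω W with hA
  have hF : (fun t : Fin d × Fin d × (Site d × Site d) => hquot η β len (shiftCfg v U₀)
        (covDerivFwd η (shiftCfg v U₀) t.1 (fun z => mlogCfg k η Ω (shiftCfg v W) z t.2.1)) t.2.2)
      = fun t => (fun t' : Fin d × Fin d × (Site d × Site d) => hquot η β len U₀ (covDerivFwd η U₀ t'.1 (fun z => A z t'.2.1)) t'.2.2)
          (t.1, t.2.1, (t.2.2.1 + v, t.2.2.2 + v)) := by
    funext t
    have hD : covDerivFwd η (shiftCfg v U₀) t.1 (fun z => mlogCfg k η Ω (shiftCfg v W) z t.2.1) =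
        shiftCfg v (covDerivFwd η U₀ t.1 (fun z => A z t.2.1)) := by
      funext x
      rw [hml, shiftCfg_apply]
      exact covDerivFwd_shiftCfg η v U₀ t.1 (fun z => A z t.2.1) x
    rw [hD, hquot_shiftCfg]
  rw [hF]
  let σ : (Fin d × Fin d × (Site d × Site d)) ≃ (Fin d × Fin d × (Site d × Site d)) :=
    { toFun := fun t => (t.1, t.2.1, (t.2.2.1 + v, t.2.2.2 + v)), invFun := fun t => (t.1, t.2.1, (t.2.2.1 - v, t.2.2.2 - v)),
      left_inv := fun t => by simp, right_inv := fun t => by simp }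
  have hσ := msup_shift_univ L k η (-(2 + β))
    (fun j (t : Fin d × Fin d × (Site d × Site d)) => t.2.2 ∈ AdmPair η len ∧ t.2.2.1 ∈ Ω j) σ
    (fun j t => by
      show (t.2.2 ∈ AdmPair η len ∧ t.2.2.1 ∈ Ω j) ↔ ((t.2.2.1 + v, t.2.2.2 + v) ∈ AdmPair η len ∧ t.2.2.1 + v ∈ Ω j)
      rw [hΩ j]
      exact and_congr_left' (admPair_shift_iff η len v t.2.2).symm)
    (fun t' => hquot η β len U₀ (covDerivFwd η U₀ t'.1 (fun z => A z t'.2.1)) t'.2.2)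
  exact (le_of_eq hσ).trans h

/-- **(1.37) (`|Q_j(U₀, ηA)| < 2dLα₁` on the class bonds) is translation covariant** at label-periodic `𝔅` (`v = Lʲq_j`) and `v`-invariant `Ω`
(`B7TranslationCovariance.logCovIter_shiftCfg`). [cite: Balaban1985RegularSpaces, (1.37) p.82, (1.28) p.81, p.77] -/
theorem c137_shiftCfg_of_periodic (L k : ℕ) (η C : ℝ) {Ω : ℕ → Set (Site d)} {Λb : ℕ → Set (Site d × Fin d)} {q : ℕ → Site d} {v : Site d}
    (hv : ∀ j, j ≤ k → v = ((L : ℤ) ^ j) • q j) (hΩ : ∀ j x, x + v ∈ Ω j ↔ x ∈ Ω j)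
    (hΛb : ∀ j, j ≤ k → ∀ (z : Site d) (κ : Fin d), (z + q j, κ) ∈ Λb j ↔ (z, κ) ∈ Λb j)
    (U₀ W : Site d → Fin d → 𝔸ˣ)
    (h : ∀ j, j ≤ k → ∀ c ∈ Λb j, ‖logCovIter L U₀ (iEta η (mlogCfg k η Ω W)) j c.1 c.2‖ < C) :
    ∀ j, j ≤ k → ∀ c ∈ Λb j, ‖logCovIter L (shiftCfg v U₀) (iEta η (mlogCfg k η Ω (shiftCfg v W))) j c.1 c.2‖ < C := by
  intro j hj c hc
  have hml : mlogCfg k η Ω (shiftCfg v W) = shiftCfg v (mlogCfg k η Ω W) := mlogCfg_shiftCfg_of_periodic k η hΩ W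
  have hι : iEta η (mlogCfg k η Ω (shiftCfg v W)) = shiftCfg v (iEta η (mlogCfg k η Ω W)) := by rw [hml]; rfl
  rw [hι, hv j hj, ← logCovIter_shiftCfg]
  exact h j hj (c.1 + q j, c.2) ((hΛb j hj c.1 c.2).2 hc)

/-- **(1.38) for a configuration (`IsLandau138W`, the Landau gauge of record) is translation covariant** at periodic geometry.
[cite: Balaban1985RegularSpaces, (1.38) p.82, p.77; Balaban1985BackgroundPropagators, (3.25) p.394] -/
theorem landauW_shiftCfg_of_periodic {L : ℕ} (hL : 1 ≤ L) (k : ℕ) (η : ℝ) {Ω₀ : Set (Site d)} {Λ : ℕ → Set (Site d)} {q : ℕ → Site d} {v : Site d}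
    (hv : ∀ j, j ≤ k → v = ((L : ℤ) ^ j) • q j) (hΩ₀ : ∀ x, x + v ∈ Ω₀ ↔ x ∈ Ω₀) (hΛ : ∀ j, j ≤ k → ∀ y, y + q j ∈ Λ j ↔ y ∈ Λ j)
    (U₀ W : Site d → Fin d → 𝔸ˣ) (h : IsLandau138W L k η Ω₀ Λ U₀ W) : IsLandau138W L k η Ω₀ Λ (shiftCfg v U₀) (shiftCfg v W) := by
  have h' : IsLandau138 L k η Ω₀ Λ U₀ (logCfg η W) := h
  have h'' := isLandau138_shiftCfg_of_periodic hL k η Ω₀ Λ U₀ (logCfg η W) q v hv hΩ₀ hΛ h'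
  rw [← logCfg_shiftCfg] at h''
  exact h''

/-- **(1.39)₁₂ (the bond norms `|D^{η*}D^ηA|₍₋₃₎`, `|Δ^η_{U₀}A|₍₋₃₎` over `Ω`) are translation covariant** at `v`-invariant `Ω_j`.
[cite: Balaban1985RegularSpaces, (1.39) p.83, p.86, p.77] -/
theorem c139_shiftCfg_of_periodic (L k : ℕ) (η C : ℝ) {Ω : ℕ → Set (Site d)} {v : Site d} (hΩ : ∀ j x, x + v ∈ Ω j ↔ x ∈ Ω j)
    (U₀ W : Site d → Fin d → 𝔸ˣ)
    (h : bondNorm L k η (-(3 : ℝ)) Ω (fun x μ => pdiv η U₀ (plaqCovDeriv η U₀ (mlogCfg k η Ω W)) μ x) ≤ C ∧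
      bondNorm L k η (-(3 : ℝ)) Ω (fun x μ => covLap η U₀ (fun z => mlogCfg k η Ω W z μ) x) ≤ C) :
    bondNorm L k η (-(3 : ℝ)) Ω (fun x μ => pdiv η (shiftCfg v U₀) (plaqCovDeriv η (shiftCfg v U₀) (mlogCfg k η Ω (shiftCfg v W))) μ x) ≤ C ∧
      bondNorm L k η (-(3 : ℝ)) Ω (fun x μ => covLap η (shiftCfg v U₀) (fun z => mlogCfg k η Ω (shiftCfg v W) z μ) x) ≤ C := by
  have hml : mlogCfg k η Ω (shiftCfg v W) = shiftCfg v (mlogCfg k η Ω W) := mlogCfg_shiftCfg_of_periodic k η hΩ W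
  set A : Site d → Fin d → 𝔸 := mlogCfg k η Ω W with hA
  have hF₁ : (fun x μ => pdiv η (shiftCfg v U₀) (plaqCovDeriv η (shiftCfg v U₀) (mlogCfg k η Ω (shiftCfg v W))) μ x) =
      shiftCfg v (fun x μ => pdiv η U₀ (plaqCovDeriv η U₀ A) μ x) := by
    funext x μ
    rw [hml, shiftCfg_apply]
    exact pdiv_plaqCovDeriv_shiftCfg η v U₀ A μ x
  have hF₂ : (fun x μ => covLap η (shiftCfg v U₀) (fun z => mlogCfg k η Ω (shiftCfg v W) z μ) x) =
      shiftCfg v (fun x μ => covLap η U₀ (fun z => A z μ) x) := by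
    funext x μ
    rw [hml, shiftCfg_apply]
    exact covLap_shiftCfg η v U₀ (fun z => A z μ) x
  rw [hF₁, hF₂, bondNorm_shiftCfg_of_periodic L k η _ hΩ, bondNorm_shiftCfg_of_periodic L k η _ hΩ]
  exact h

end Clauses

/-! ## §5 THE TRANSFERS: Theorems 4 and 2 pass from the `zdGF3` family to the periodic family -/

section Transfer

variable {𝔸 : Type} [CStarAlgebra 𝔸] {L : ℕ} {β : ℝ} {len : Site d → ℝ}

/-- The label translation at level `j` of a period `P` with `Lʲ ∣ P`: `P·m = Lʲ·((P∕Lʲ)·m)`. [cite: Balaban1985RegularSpaces, p.77 («Ω_j ⊂ T_η», big blocks of `T_{L^{-j}}`)] -/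
theorem period_smul_eq_pow_smul {P j : ℕ} (h : L ^ j ∣ P) (m : Site d) :
    ((P : ℕ) : ℤ) • m = ((L : ℤ) ^ j) • ((((P / L ^ j : ℕ) : ℤ)) • m) := by
  rw [← mul_smul]
  congr 1
  have hP : (P : ℤ) = ((L ^ j * (P / L ^ j) : ℕ) : ℤ) := by rw [Nat.mul_div_cancel' h]
  rw [hP]
  push_cast
  ring

/-- **THE DEVICE «UNIQUENESS ⇒ PERIODICITY»** for the ℤᵈ member `zdGF3 … i` with `P`-periodic geometry: if a gauge transformation `u` is the UNIQUE
one (among `zdGF3.GT`) with a property `C`, `C u` holds, and `C` passes from `u` to every period translate `t_{P·m}u`, then `u` is `P`-periodic.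
[cite: Balaban1985RegularSpaces, Thm 2 p.83 ∕ Thm 4 p.88 («exactly one gauge transformation u»), p.77 («Ω_j ⊂ T_η»)] -/
theorem isPeriodic_of_unique {i : ZdIdx d L} {P : ℕ} (hΩ₀ : IsPeriodic P (fun x : Site d => x ∈ i.Ω 0))
    (C : (zdGF3 𝔸 L β len i).GT → Prop) (u : (zdGF3 𝔸 L β len i).GT) (huniq : ∀ u', C u' → u' = u)
    (hshift : ∀ m : Site d, ∀ u' : (zdGF3 𝔸 L β len i).GT, (u'.1 : Site d → 𝔸ˣ) = shiftCfg (((P : ℕ) : ℤ) • m) u.1 → C u') :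
    IsPeriodic P u.1 := by
  intro x m
  let ut : (zdGF3 𝔸 L β len i).GT :=
    ⟨shiftCfg (((P : ℕ) : ℤ) • m) u.1, fun y => u.2.1 (y + ((P : ℕ) : ℤ) • m),
      fun y hy => u.2.2 (y + ((P : ℕ) : ℤ) • m) (fun h => hy ((Iff.of_eq (hΩ₀ y m)).1 h))⟩
  have hut : ut = u := huniq ut (hshift m ut rfl)
  have h := congrArg (fun w : (zdGF3 𝔸 L β len i).GT => (w.1 : Site d → 𝔸ˣ) x) hut
  simpa [ut, shiftCfg_apply] using h

/-- ★★★ **THEOREM 4 TRANSFERS TO THE PERIODIC FAMILY** (same threshold `c₁`, same `B₁′`): along any index map `ι` and period map `p` such that at every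
member the domains `Ω_l` are `p j`-periodic, `L^k ∣ p j`, and the top towers `Λs k l` ∕ bond classes `Λb k l` (`l ≤ k`) are `(p j ∕ Lˡ)`-periodic in
level-`l` labels, `B8.Thm4Printed B₁′ (zdGF3 ∘ ι) → B8.Thm4Printed B₁′ (zdGF3Per ∘ (ι, p))`.  PROOF: hypotheses of the periodic member ARE the ℤᵈ
member's (P1 §3); the ℤᵈ witness `u` is periodic because each translate `t_{P·m}u` satisfies (1.29), (1.37), (1.38), (1.62) for the same periodic data
(§3–§4 + `mgauge` covariance) and print's «exactly one» identifies it with `u`; uniqueness in the periodic class is the ℤᵈ one.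
[cite: Balaban1985RegularSpaces, Thm 4 p.88 («there exists exactly one gauge transformation u»), (1.29) p.81, (1.37)–(1.38) p.82, (1.62) p.87, p.77 («Ω_j ⊂ T_η»)] -/
theorem thm4Printed_per_of_zd (hL : 1 ≤ L) {J : Type} (ι : J → ZdIdx d L) (p : J → ℕ)
    (hΩ : ∀ j l, IsPeriodic (p j) (fun x : Site d => x ∈ (ι j).Ω l))
    (hdvd : ∀ j, L ^ (ι j).k ∣ p j)
    (hΛs : ∀ j l, l ≤ (ι j).k → IsPeriodic (p j / L ^ l) (fun y : Site d => y ∈ (ι j).Λs (ι j).k l))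
    (hΛb : ∀ j l, l ≤ (ι j).k → ∀ κ : Fin d, IsPeriodic (p j / L ^ l) (fun z : Site d => (z, κ) ∈ (ι j).Λb (ι j).k l))
    {B₁' : ℝ} (h : B8.Thm4Printed B₁' (fun j : J => (zdGF3 𝔸 L β len (ι j)).toGFData)) :
    B8.Thm4Printed B₁' (fun j : J => (zdGF3Per 𝔸 L β len (ι j) (p j)).toGFData) := by
  obtain ⟨c₁, hc₁, H⟩ := h
  refine ⟨c₁, hc₁, fun j α₀ α₁ hα₀ hα₁ hs U₀ Q hInA hReg hInAAx h166 => ?_⟩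
  obtain ⟨u, hR, hcl, huniq⟩ := H j α₀ α₁ hα₀ hα₁ hs (cfgZd U₀) (pertZd Q) hInA hReg hInAAx h166
  -- abbreviations
  have hΩv : ∀ (m : Site d) (l : ℕ) (y : Site d), y + (((p j : ℕ) : ℤ) • m) ∈ (ι j).Ω l ↔ y ∈ (ι j).Ω l :=
    fun m l y => Iff.of_eq (hΩ j l y m)
  have hvq : ∀ (m : Site d) (l : ℕ), l ≤ (ι j).k → (((p j : ℕ) : ℤ) • m) = ((L : ℤ) ^ l) • ((((p j / L ^ l : ℕ) : ℤ)) • m) :=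
    fun m l hl => period_smul_eq_pow_smul ((pow_dvd_pow L hl).trans (hdvd j)) m
  have hΛsv : ∀ (m : Site d) (l : ℕ), l ≤ (ι j).k → ∀ y, y + (((p j / L ^ l : ℕ) : ℤ)) • m ∈ (ι j).Λs (ι j).k l ↔ y ∈ (ι j).Λs (ι j).k l :=
    fun m l hl y => Iff.of_eq (hΛs j l hl y m)
  have hΛbv : ∀ (m : Site d) (l : ℕ), l ≤ (ι j).k → ∀ (z : Site d) (κ : Fin d),
      (z + (((p j / L ^ l : ℕ) : ℤ)) • m, κ) ∈ (ι j).Λb (ι j).k l ↔ (z, κ) ∈ (ι j).Λb (ι j).k l :=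
    fun m l hl z κ => Iff.of_eq (hΛb j l hl κ z m)
  -- the ℤᵈ witness is periodic: «exactly one» + covariance of (1.29), (1.37), (1.38), (1.62)
  have hper : IsPeriodic (p j) u.1 := by
    refine isPeriodic_of_unique (hΩ j 0)
      (fun w => (zdGF3 𝔸 L β len (ι j)).Restricted (cfgZd U₀) w ∧
        ((zdGF3 𝔸 L β len (ι j)).C137 α₁ (cfgZd U₀) ((zdGF3 𝔸 L β len (ι j)).act (pertZd Q) w) ∧
          (zdGF3 𝔸 L β len (ι j)).Landau (cfgZd U₀) ((zdGF3 𝔸 L β len (ι j)).act (pertZd Q) w) ∧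
          (zdGF3 𝔸 L β len (ι j)).C162 B₁' (α₀ + α₁) (cfgZd U₀) ((zdGF3 𝔸 L β len (ι j)).act (pertZd Q) w)))
      u (fun u' hu' => huniq u' hu'.1 hu'.2.1 hu'.2.2.1 hu'.2.2.2) (fun m u' hu' => ?_)
    obtain ⟨h137, hLan, h162⟩ := hcl
    -- the clauses for `u`, in concrete form: background `U₀.1`, field `W = (Q.1)^{…}` gauge-fixed by `u`
    set W : Site d → Fin d → 𝔸ˣ := mgauge Q.1.1 u.1⁻¹ Q.2.1 with hW
    have hR' : Restr129 L (ι j).k ((ι j).Λs (ι j).k) U₀.1 u.1 := hR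
    have h137' : ∀ l, l ≤ (ι j).k → ∀ c ∈ (ι j).Λb (ι j).k l,
        ‖logCovIter L U₀.1 (iEta (ι j).η (mlogCfg (ι j).k (ι j).η (ι j).Ω W)) l c.1 c.2‖ < 2 * d * L * α₁ := h137
    have hLan' : IsLandau138W L (ι j).k (ι j).η ((ι j).Ω 0) ((ι j).Λs (ι j).k) U₀.1 W := hLan
    have h162' : ∀ l, l ≤ (ι j).k → ∀ b ∈ {b : Site d × Fin d | SideTouches ((ι j).Ω l) b.1 b.2},
        W b.1 b.2 = cfgExp (ι j).η (logCfg (ι j).η W) b.1 b.2 ∧ IsSelfAdjoint (logCfg (ι j).η W b.1 b.2) ∧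
          ‖logCfg (ι j).η W b.1 b.2‖ ≤ B₁' * (α₀ + α₁) * ((L : ℝ) ^ l * (ι j).η)⁻¹ := h162
    -- translate them
    have hRt := restr129_shiftCfg_of_periodic L (ι j).k ((ι j).Λs (ι j).k) U₀.1 u.1 (fun l => (((p j / L ^ l : ℕ) : ℤ)) • m) (((p j : ℕ) : ℤ) • m)
      (hvq m) (hΛsv m) hR'
    have h137t := c137_shiftCfg_of_periodic L (ι j).k (ι j).η (2 * d * L * α₁) (hvq m) (hΩv m) (hΛbv m) U₀.1 W h137'
    have hLant := landauW_shiftCfg_of_periodic hL (ι j).k (ι j).η (hvq m) (hΩv m 0) (hΛsv m) U₀.1 W hLan'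
    have h162t := c162_shiftCfg_of_periodic L (ι j).k (ι j).η (B₁' * (α₀ + α₁)) (hΩv m) W h162'
    -- read back at the ORIGINAL (periodic) data
    have hU₀v : shiftCfg (((p j : ℕ) : ℤ) • m) U₀.1 = U₀.1 := funext fun y => U₀.2.2 y m
    have hQ1v : shiftCfg (((p j : ℕ) : ℤ) • m) Q.1.1 = Q.1.1 := funext fun y => Q.1.2.2 y m
    have hQ2v : shiftCfg (((p j : ℕ) : ℤ) • m) Q.2.1 = Q.2.1 := funext fun y => Q.2.2.2 y m
    have hWt : mgauge Q.1.1 (u'.1)⁻¹ Q.2.1 = shiftCfg (((p j : ℕ) : ℤ) • m) W := by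
      have hm := mgauge_shiftCfg (((p j : ℕ) : ℤ) • m) Q.1.1 u.1⁻¹ Q.2.1
      rw [hQ1v, hQ2v] at hm
      rw [hu']
      exact hm
    rw [hU₀v] at hRt h137t hLant
    rw [← hWt] at h137t hLant h162t
    refine ⟨?_, h137t, hLant, h162t⟩
    show Restr129 L (ι j).k ((ι j).Λs (ι j).k) U₀.1 u'.1
    rw [hu']; exact hRt
  -- the periodic witness
  refine ⟨⟨u.1, u.2, hper⟩, hR, hcl, fun u' hR' h137' hLan' h162' => ?_⟩
  have h := huniq (gtZd u') hR' h137' hLan' h162'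
  have h1 : u'.1 = u.1 := congrArg Subtype.val h
  exact Subtype.ext h1

/-- ★★★ **THEOREM 2 TRANSFERS TO THE PERIODIC FAMILY** (same `B₁, B₂, c₁`): along `ι, p` as in `thm4Printed_per_of_zd`,
`B8.Thm2Printed (zdGF3 ∘ ι) → B8.Thm2Printed (zdGF3Per ∘ (ι, p))` — the ℤᵈ witness is periodic by «exactly one» and the covariance of (1.29),
(1.36)₁₂₃, (1.37), (1.38), (1.39)₁₂ (§3–§4); uniqueness in the periodic class is the ℤᵈ one restricted.
[cite: Balaban1985RegularSpaces, Thm 2 p.83 («there exists exactly one gauge transformation u»), (1.29) p.81, (1.36)–(1.39) pp.82–83, p.77 («Ω_j ⊂ T_η»)] -/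
theorem thm2Printed_per_of_zd (hL : 1 ≤ L) {J : Type} (ι : J → ZdIdx d L) (p : J → ℕ)
    (hΩ : ∀ j l, IsPeriodic (p j) (fun x : Site d => x ∈ (ι j).Ω l))
    (hdvd : ∀ j, L ^ (ι j).k ∣ p j)
    (hΛs : ∀ j l, l ≤ (ι j).k → IsPeriodic (p j / L ^ l) (fun y : Site d => y ∈ (ι j).Λs (ι j).k l))
    (hΛb : ∀ j l, l ≤ (ι j).k → ∀ κ : Fin d, IsPeriodic (p j / L ^ l) (fun z : Site d => (z, κ) ∈ (ι j).Λb (ι j).k l))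
    (h : B8.Thm2Printed (fun j : J => (zdGF3 𝔸 L β len (ι j)).toGFData)) :
    B8.Thm2Printed (fun j : J => (zdGF3Per 𝔸 L β len (ι j) (p j)).toGFData) := by
  obtain ⟨B₁, B₂, c₁, hB₁, hB₂, hc₁, H⟩ := h
  refine ⟨B₁, B₂, c₁, hB₁, hB₂, hc₁, fun j α₀ α₁ hα₀ hα₁ hs U₀ Q hInA hReg hInAAx h135 => ?_⟩
  obtain ⟨u, hR, hcl, huniq⟩ := H j α₀ α₁ hα₀ hα₁ hs (cfgZd U₀) (pertZd Q) hInA hReg hInAAx h135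
  have hΩv : ∀ (m : Site d) (l : ℕ) (y : Site d), y + (((p j : ℕ) : ℤ) • m) ∈ (ι j).Ω l ↔ y ∈ (ι j).Ω l :=
    fun m l y => Iff.of_eq (hΩ j l y m)
  have hvq : ∀ (m : Site d) (l : ℕ), l ≤ (ι j).k → (((p j : ℕ) : ℤ) • m) = ((L : ℤ) ^ l) • ((((p j / L ^ l : ℕ) : ℤ)) • m) :=
    fun m l hl => period_smul_eq_pow_smul ((pow_dvd_pow L hl).trans (hdvd j)) m
  have hΛsv : ∀ (m : Site d) (l : ℕ), l ≤ (ι j).k → ∀ y, y + (((p j / L ^ l : ℕ) : ℤ)) • m ∈ (ι j).Λs (ι j).k l ↔ y ∈ (ι j).Λs (ι j).k l :=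
    fun m l hl y => Iff.of_eq (hΛs j l hl y m)
  have hΛbv : ∀ (m : Site d) (l : ℕ), l ≤ (ι j).k → ∀ (z : Site d) (κ : Fin d),
      (z + (((p j / L ^ l : ℕ) : ℤ)) • m, κ) ∈ (ι j).Λb (ι j).k l ↔ (z, κ) ∈ (ι j).Λb (ι j).k l :=
    fun m l hl z κ => Iff.of_eq (hΛb j l hl κ z m)
  have hper : IsPeriodic (p j) u.1 := by
    refine isPeriodic_of_unique (hΩ j 0)
      (fun w => (zdGF3 𝔸 L β len (ι j)).Restricted (cfgZd U₀) w ∧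
        ((zdGF3 𝔸 L β len (ι j)).C136 B₁ B₂ (α₀ + α₁) (cfgZd U₀) ((zdGF3 𝔸 L β len (ι j)).act (pertZd Q) w) ∧
          (zdGF3 𝔸 L β len (ι j)).C137 α₁ (cfgZd U₀) ((zdGF3 𝔸 L β len (ι j)).act (pertZd Q) w) ∧
          (zdGF3 𝔸 L β len (ι j)).Landau (cfgZd U₀) ((zdGF3 𝔸 L β len (ι j)).act (pertZd Q) w) ∧
          (zdGF3 𝔸 L β len (ι j)).C139 B₁ (α₀ + α₁) (cfgZd U₀) ((zdGF3 𝔸 L β len (ι j)).act (pertZd Q) w)))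
      u (fun u' hu' => huniq u' hu'.1 hu'.2.1 hu'.2.2.1 hu'.2.2.2.1 hu'.2.2.2.2) (fun m u' hu' => ?_)
    obtain ⟨h136, h137, hLan, h139⟩ := hcl
    set W : Site d → Fin d → 𝔸ˣ := mgauge Q.1.1 u.1⁻¹ Q.2.1 with hW
    have hR' : Restr129 L (ι j).k ((ι j).Λs (ι j).k) U₀.1 u.1 := hR
    have h136' : (∀ l, l ≤ (ι j).k → ∀ b ∈ {b : Site d × Fin d | SideTouches ((ι j).Ω l) b.1 b.2},
          W b.1 b.2 = cfgExp (ι j).η (logCfg (ι j).η W) b.1 b.2 ∧ IsSelfAdjoint (logCfg (ι j).η W b.1 b.2) ∧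
            ‖logCfg (ι j).η W b.1 b.2‖ ≤ B₁ * (α₀ + α₁) * ((L : ℝ) ^ l * (ι j).η)⁻¹) ∧
        msup L (ι j).k (ι j).η (-(2 : ℝ)) (fun l (t : Fin d × Fin d × Site d) => SideTouches ((ι j).Ω l) t.2.2 t.2.1)
            (fun t => covDerivFwd (ι j).η U₀.1 t.1 (fun z => mlogCfg (ι j).k (ι j).η (ι j).Ω W z t.2.1) t.2.2) ≤ B₁ * (α₀ + α₁) ∧
        msup L (ι j).k (ι j).η (-(2 + β)) (fun l (t : Fin d × Fin d × (Site d × Site d)) => t.2.2 ∈ AdmPair (ι j).η len ∧ t.2.2.1 ∈ (ι j).Ω l)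
            (fun t => hquot (ι j).η β len U₀.1 (covDerivFwd (ι j).η U₀.1 t.1 (fun z => mlogCfg (ι j).k (ι j).η (ι j).Ω W z t.2.1)) t.2.2)
            ≤ B₂ * (α₀ + α₁) := h136
    have h137' : ∀ l, l ≤ (ι j).k → ∀ c ∈ (ι j).Λb (ι j).k l,
        ‖logCovIter L U₀.1 (iEta (ι j).η (mlogCfg (ι j).k (ι j).η (ι j).Ω W)) l c.1 c.2‖ < 2 * d * L * α₁ := h137
    have hLan' : IsLandau138W L (ι j).k (ι j).η ((ι j).Ω 0) ((ι j).Λs (ι j).k) U₀.1 W := hLan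
    have h139' : bondNorm L (ι j).k (ι j).η (-(3 : ℝ)) (ι j).Ω
          (fun x μ => pdiv (ι j).η U₀.1 (plaqCovDeriv (ι j).η U₀.1 (mlogCfg (ι j).k (ι j).η (ι j).Ω W)) μ x) ≤ B₁ * (α₀ + α₁) ∧
        bondNorm L (ι j).k (ι j).η (-(3 : ℝ)) (ι j).Ω
          (fun x μ => covLap (ι j).η U₀.1 (fun z => mlogCfg (ι j).k (ι j).η (ι j).Ω W z μ) x) ≤ B₁ * (α₀ + α₁) := h139
    obtain ⟨h136a, h136g, h136h⟩ := h136'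
    have hRt := restr129_shiftCfg_of_periodic L (ι j).k ((ι j).Λs (ι j).k) U₀.1 u.1 (fun l => (((p j / L ^ l : ℕ) : ℤ)) • m) (((p j : ℕ) : ℤ) • m)
      (hvq m) (hΛsv m) hR'
    have h136at := c162_shiftCfg_of_periodic L (ι j).k (ι j).η (B₁ * (α₀ + α₁)) (hΩv m) W h136a
    have h136gt := c136grad_shiftCfg_of_periodic L (ι j).k (ι j).η (B₁ * (α₀ + α₁)) (hΩv m) U₀.1 W h136g
    have h136ht := c136holder_shiftCfg_of_periodic L (ι j).k (ι j).η β len (B₂ * (α₀ + α₁)) (hΩv m) U₀.1 W h136h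
    have h137t := c137_shiftCfg_of_periodic L (ι j).k (ι j).η (2 * d * L * α₁) (hvq m) (hΩv m) (hΛbv m) U₀.1 W h137'
    have hLant := landauW_shiftCfg_of_periodic hL (ι j).k (ι j).η (hvq m) (hΩv m 0) (hΛsv m) U₀.1 W hLan'
    have h139t := c139_shiftCfg_of_periodic L (ι j).k (ι j).η (B₁ * (α₀ + α₁)) (hΩv m) U₀.1 W h139'
    have hU₀v : shiftCfg (((p j : ℕ) : ℤ) • m) U₀.1 = U₀.1 := funext fun y => U₀.2.2 y m
    have hQ1v : shiftCfg (((p j : ℕ) : ℤ) • m) Q.1.1 = Q.1.1 := funext fun y => Q.1.2.2 y m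
    have hQ2v : shiftCfg (((p j : ℕ) : ℤ) • m) Q.2.1 = Q.2.1 := funext fun y => Q.2.2.2 y m
    have hWt : mgauge Q.1.1 (u'.1)⁻¹ Q.2.1 = shiftCfg (((p j : ℕ) : ℤ) • m) W := by
      have hm := mgauge_shiftCfg (((p j : ℕ) : ℤ) • m) Q.1.1 u.1⁻¹ Q.2.1
      rw [hQ1v, hQ2v] at hm
      rw [hu']
      exact hm
    rw [hU₀v] at hRt h136gt h136ht h137t hLant h139t
    rw [← hWt] at h136at h136gt h136ht h137t hLant h139t
    refine ⟨?_, ⟨h136at, h136gt, h136ht⟩, h137t, hLant, h139t⟩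
    show Restr129 L (ι j).k ((ι j).Λs (ι j).k) U₀.1 u'.1
    rw [hu']; exact hRt
  refine ⟨⟨u.1, u.2, hper⟩, hR, hcl, fun u' hR' h136' h137' hLan' h139' => ?_⟩
  have h := huniq (gtZd u') hR' h136' h137' hLan' h139'
  have h1 : u'.1 = u.1 := congrArg Subtype.val h
  exact Subtype.ext h1

end Transfer

end Literature.MathematicalPhysics.QuantumFieldTheory.Balaban1983to89.B8LeafModelZdPerTransfer
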